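import Literature.AlgebraicGeometry.Motives.IntegralModelReductionMap
import HarnessLib

/-!
# The reduction map of a proper integral model: integral points and surjectivity from a lifting property
# ([SerreTate1968] §1; [Hartshorne1977] II.4.7; [BLRNeronModels1990] §2.3 Prop. 5)

Topic `Literature/AlgebraicGeometry/Motives`, namespace `Literature.AlgebraicGeometry.Motives.IntegralModel`.  THEOREMS only (no def, no
instance, no notation, no named fact, no `sorry`).  Cell `hodgecm-mathlib` (D-0151), FLOOR 0, programme F0P5a (D9op road 2′, crux item
stmt-HodgeConjecture-24832): the INTERFACE between row H of the ED4 cut («every `κ̄`-point `z` of the special fibre of the smooth proper model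
`𝒮 ⊗ 𝒮` is a reduction: `z = red(x, y)`», §8 step 1) and the group-free reduction map ★ `IntegralModel.geomReductionMap` (D1, p793383).

Base `R = closureValuationSubring (v.adicCompletion K) ⊆ Ω = \overline{K_v}`, `f = toClosureValuationSubring v : 𝓞ᵥ → R`, residue field `κ(R)`
(read in `κ̄(v)` by ★ `geomClosedPointIsoSpecResidueField`).  For a PROPER integral model `𝒳` of `X` at `v`:

* `reductionPoint_bijective` — `𝒳(κ(R)) → 𝒳_v(κ̄(v))` is a bijection (adjunction + the two ★ isomorphisms of closed points);
* **`geomReductionMap_modelPointsEquiv_restrictPoint`** — the reduction of an `Ω`-point that is the generic point of an `R`-point `l` of `𝒳`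
  is the specialisation of `l` (uniqueness half of the valuative criterion, ★ `extendPoint_restrictPoint`);
* **`exists_geomReductionMap_eq_of_exists_lift`**, **`geomReductionMap_surjective_of_forall_exists_lift`** — if a `κ(R)`-point `y` of `𝒳`
  lifts to an `R`-point (`ι_κ ≫ l = y`: Hensel's lemma for `𝒳` smooth and `R` henselian, [BLRNeronModels1990] §2.3 Prop. 5; or the
  flat-proper road via closed points of the generic fibre, [Liu2002] 10.1.36–38), then `reductionPoint y` is a reduction `red_𝒳 x`; if every
  `y` lifts, `red_𝒳 : X(Ω) → 𝒳_v(κ̄(v))` is SURJECTIVE — the consumed form of `stub_H` in the F0P5a composition;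
* `geomReductionMap_surjective_iff_forall_exists_lift` — conversely surjectivity of `red_𝒳` gives all lifts (the extension ★ `extendPoint` of a
  preimage is a lift), so the two phrasings of H are equivalent.

HC_CM is proved only modulo the 7 printed citations until rung 0 closes; this file is a generic leaf and changes no count.

## References
* [SerreTate1968] J.-P. Serre, J. Tate, *Good reduction of abelian varieties*, Ann. of Math. 88 (1968), §1.
* [Hartshorne1977] R. Hartshorne, *Algebraic Geometry*, II.4.7 (valuative criterion), II.3 Thm. 3.3.
* [BLRNeronModels1990] S. Bosch, W. Lütkebohmert, M. Raynaud, *Néron Models*, §2.3 Prop. 5 (lifting of points over henselian bases for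
  smooth schemes).
-/

set_option autoImplicit false

noncomputable section

open CategoryTheory AlgebraicGeometry IsDedekindDomain IsDedekindDomain.HeightOneSpectrum
open scoped NumberField
open Literature.NumberTheory.EllipticCurves (genericFibre specGenericPoint)
open Literature.NumberTheory.GaloisRepresentations (closureValuationSubring)
open Literature.NumberTheory.DiophantineGeometry

namespace Literature.AlgebraicGeometry.Motives

namespace IntegralModel

variable {K : Type} [Field K] [NumberField K] {v : HeightOneSpectrum (𝓞 K)} {X : SchemeOver K}

/-! ### `reductionPoint` is a bijection `𝒳(κ(R)) ≃ 𝒳_v(κ̄(v))` -/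

/-- An explicit preimage under `reductionPoint`: re-base a `κ̄(v)`-point of the special fibre to a `κ(R)`-point of the total space
(inverse adjunction and the two closed-point isomorphisms). [cite: Hartshorne1977, II.3 Thm. 3.3 (fibre product, universal property)] -/
theorem reductionPoint_comp_homEquiv_symm (𝒳 : IntegralModel (valuationSubringAtPrime K v) K X)
    (z : AlgPoints 𝒳.reductionAt (geomResidueField v)) :
    𝒳.reductionPoint ((geomClosedPointIsoSpecResidueField v).hom ≫ (geomClosedPointIso v).hom ≫
      ((Over.mapPullbackAdj (specResidueField v)).homEquiv _ 𝒳.total).symm z) = z := by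
  rw [reductionPoint, Iso.inv_hom_id_assoc, Iso.inv_hom_id_assoc, Equiv.apply_symm_apply]

/-- `reductionPoint : 𝒳(κ(R)) → 𝒳_v(κ̄(v))` is surjective. [cite: Hartshorne1977, II.3 Thm. 3.3 (fibre product, universal property)] -/
theorem reductionPoint_surjective (𝒳 : IntegralModel (valuationSubringAtPrime K v) K X) : Function.Surjective 𝒳.reductionPoint :=
  fun z => ⟨_, 𝒳.reductionPoint_comp_homEquiv_symm z⟩

/-- `reductionPoint : 𝒳(κ(R)) → 𝒳_v(κ̄(v))` is injective. [cite: Hartshorne1977, II.3 Thm. 3.3 (fibre product, universal property)] -/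
theorem reductionPoint_injective (𝒳 : IntegralModel (valuationSubringAtPrime K v) K X) : Function.Injective 𝒳.reductionPoint := by
  intro y y' h
  have h' := ((Over.mapPullbackAdj (specResidueField v)).homEquiv _ 𝒳.total).injective h
  rwa [cancel_epi, cancel_epi] at h'

/-- `reductionPoint : 𝒳(κ(R)) → 𝒳_v(κ̄(v))` is a bijection. [cite: Hartshorne1977, II.3 Thm. 3.3 (fibre product, universal property)] -/
theorem reductionPoint_bijective (𝒳 : IntegralModel (valuationSubringAtPrime K v) K X) : Function.Bijective 𝒳.reductionPoint :=
  ⟨𝒳.reductionPoint_injective, 𝒳.reductionPoint_surjective⟩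

/-! ### The reduction of the generic point of an integral point -/

/-- **The reduction of an `Ω`-point that extends is the specialisation of its extension** ([SerreTate1968] §1; uniqueness in the valuative
criterion, ★ `extendPoint_restrictPoint`): for an `R`-point `l : Spec R → 𝒳` over `𝓞ᵥ`,
`red_𝒳 (e_𝒳 (l|_{Spec Ω})) = reductionPoint (ι_κ ≫ l)`. [cite: SerreTate1968, §1] [cite: Hartshorne1977, II.4.7] -/
theorem geomReductionMap_modelPointsEquiv_restrictPoint (𝒳 : IntegralModel (valuationSubringAtPrime K v) K X) [IsProper 𝒳.total.hom]
    (l : specValuationSubring (closureValuationSubring (v.adicCompletion K)) (toClosureValuationSubring v) ⟶ 𝒳.total) :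
    𝒳.geomReductionMap (𝒳.modelPointsEquiv
        (restrictPoint (closureValuationSubring (v.adicCompletion K)) (toClosureValuationSubring v) 𝒳.total l)) =
      𝒳.reductionPoint
        (specRingHomι (closureValuationSubring (v.adicCompletion K)) (toClosureValuationSubring v)
            (IsLocalRing.residue (closureValuationSubring (v.adicCompletion K))) ≫ l) := by
  rw [geomReductionMap_def, Equiv.symm_apply_apply, extendPoint_restrictPoint]

-- (the converse reading `red_𝒳 x = reductionPoint (ι_κ ≫ extendPoint (e_𝒳⁻¹ x))` is ★ `geomReductionMap_def`)

/-! ### Surjectivity of the reduction map from a lifting property (the consumed form of row H) -/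

/-- **A `κ(R)`-point that lifts is a reduction** ([SerreTate1968] §1): if `y ∈ 𝒳(κ(R))` is the specialisation `ι_κ ≫ l` of an `R`-point `l`,
then `reductionPoint y = red_𝒳 x` for the `Ω`-point `x = e_𝒳 (l|_{Spec Ω})`. [cite: SerreTate1968, §1] [cite: Hartshorne1977, II.4.7] -/
theorem exists_geomReductionMap_eq_reductionPoint_of_exists_lift (𝒳 : IntegralModel (valuationSubringAtPrime K v) K X)
    [IsProper 𝒳.total.hom] (y : residueFieldPoints 𝒳.total)
    (hy : ∃ l : specValuationSubring (closureValuationSubring (v.adicCompletion K)) (toClosureValuationSubring v) ⟶ 𝒳.total,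
      specRingHomι (closureValuationSubring (v.adicCompletion K)) (toClosureValuationSubring v)
          (IsLocalRing.residue (closureValuationSubring (v.adicCompletion K))) ≫ l = y) :
    ∃ x : AlgPoints X (AlgebraicClosure (v.adicCompletion K)), 𝒳.geomReductionMap x = 𝒳.reductionPoint y := by
  obtain ⟨l, rfl⟩ := hy
  exact ⟨_, 𝒳.geomReductionMap_modelPointsEquiv_restrictPoint l⟩

/-- **A `κ̄(v)`-point of the special fibre whose `κ(R)`-point lifts is a reduction**: pointwise form for `z ∈ 𝒳_v(κ̄(v))` (the flat-proper
road gives lifts point by point). [cite: SerreTate1968, §1] [cite: Hartshorne1977, II.4.7] -/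
theorem exists_geomReductionMap_eq_of_exists_lift (𝒳 : IntegralModel (valuationSubringAtPrime K v) K X) [IsProper 𝒳.total.hom]
    (z : AlgPoints 𝒳.reductionAt (geomResidueField v))
    (hz : ∃ l : specValuationSubring (closureValuationSubring (v.adicCompletion K)) (toClosureValuationSubring v) ⟶ 𝒳.total,
      𝒳.reductionPoint (specRingHomι (closureValuationSubring (v.adicCompletion K)) (toClosureValuationSubring v)
          (IsLocalRing.residue (closureValuationSubring (v.adicCompletion K))) ≫ l) = z) :
    ∃ x : AlgPoints X (AlgebraicClosure (v.adicCompletion K)), 𝒳.geomReductionMap x = z := by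
  obtain ⟨l, rfl⟩ := hz
  exact ⟨_, 𝒳.geomReductionMap_modelPointsEquiv_restrictPoint l⟩

/-- **Surjectivity of the reduction map from the lifting property** ([SerreTate1968] §1; [BLRNeronModels1990] §2.3 Prop. 5): if EVERY
`κ(R)`-point of the proper model `𝒳` lifts to an `R`-point (e.g. `𝒳` smooth over `𝓞ᵥ` and `R` henselian with algebraically closed residue
field), then `red_𝒳 : X(Ω) → 𝒳_v(κ̄(v))` is surjective — §8 step 1 of the F0P5a composition («`z = red(x, y)`»).
[cite: SerreTate1968, §1] [cite: BLRNeronModels1990, §2.3 Prop. 5] -/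
theorem geomReductionMap_surjective_of_forall_exists_lift (𝒳 : IntegralModel (valuationSubringAtPrime K v) K X) [IsProper 𝒳.total.hom]
    (hH : ∀ y : residueFieldPoints 𝒳.total,
      ∃ l : specValuationSubring (closureValuationSubring (v.adicCompletion K)) (toClosureValuationSubring v) ⟶ 𝒳.total,
        specRingHomι (closureValuationSubring (v.adicCompletion K)) (toClosureValuationSubring v)
            (IsLocalRing.residue (closureValuationSubring (v.adicCompletion K))) ≫ l = y) :
    Function.Surjective 𝒳.geomReductionMap := by
  intro z
  obtain ⟨y, rfl⟩ := 𝒳.reductionPoint_surjective z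
  exact 𝒳.exists_geomReductionMap_eq_reductionPoint_of_exists_lift y (hH y)

/-- **Conversely, surjectivity of `red_𝒳` gives all lifts**: the extension (★ `extendPoint`) of a preimage of `reductionPoint y` is an `R`-point
specialising to `y` (injectivity of `reductionPoint`). [cite: SerreTate1968, §1] [cite: Hartshorne1977, II.4.7] -/
theorem exists_lift_of_geomReductionMap_surjective (𝒳 : IntegralModel (valuationSubringAtPrime K v) K X) [IsProper 𝒳.total.hom]
    (hred : Function.Surjective 𝒳.geomReductionMap) (y : residueFieldPoints 𝒳.total) :
    ∃ l : specValuationSubring (closureValuationSubring (v.adicCompletion K)) (toClosureValuationSubring v) ⟶ 𝒳.total,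
      specRingHomι (closureValuationSubring (v.adicCompletion K)) (toClosureValuationSubring v)
          (IsLocalRing.residue (closureValuationSubring (v.adicCompletion K))) ≫ l = y := by
  obtain ⟨x, hx⟩ := hred (𝒳.reductionPoint y)
  exact ⟨_, 𝒳.reductionPoint_injective hx⟩

/-- The two phrasings of row H agree: `red_𝒳` is surjective iff every `κ(R)`-point of `𝒳` lifts to an `R`-point.
[cite: SerreTate1968, §1] [cite: Hartshorne1977, II.4.7] -/
theorem geomReductionMap_surjective_iff_forall_exists_lift (𝒳 : IntegralModel (valuationSubringAtPrime K v) K X) [IsProper 𝒳.total.hom] :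
    Function.Surjective 𝒳.geomReductionMap ↔
      ∀ y : residueFieldPoints 𝒳.total,
        ∃ l : specValuationSubring (closureValuationSubring (v.adicCompletion K)) (toClosureValuationSubring v) ⟶ 𝒳.total,
          specRingHomι (closureValuationSubring (v.adicCompletion K)) (toClosureValuationSubring v)
              (IsLocalRing.residue (closureValuationSubring (v.adicCompletion K))) ≫ l = y :=
  ⟨𝒳.exists_lift_of_geomReductionMap_surjective, 𝒳.geomReductionMap_surjective_of_forall_exists_lift⟩

end IntegralModel

end Literature.AlgebraicGeometry.Motives

end
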